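import Summits.BirchSwinnertonDyer.BirchSwinnertonDyer.Theorems.PrintCf2RamifiedOffTYZTheoremAHeegnerOrbit
import Summits.BirchSwinnertonDyer.BirchSwinnertonDyer.Theorems.PrintCf2RamifiedOffTYZTheoremAHeegnerFree
import Summits.BirchSwinnertonDyer.BirchSwinnertonDyer.Theorems.PrintCf2RamifiedOffTYZTheoremATransport
import Summits.BirchSwinnertonDyer.BirchSwinnertonDyer.Theorems.PrintCf2RamifiedOffTYZTheoremATargets
import Summits.BirchSwinnertonDyer.BirchSwinnertonDyer.Theorems.PrintCf2RamifiedOffTYZTheoremARealisation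
import Summits.BirchSwinnertonDyer.BirchSwinnertonDyer.Theorems.PrintCf2RamifiedOffTYZTheoremAFieldTransport
import Literature.NumberTheory.EllipticCurves.LeadingTerm
import Literature.NumberTheory.EllipticCurves.AnalyticRank
import Literature.NumberTheory.EllipticCurves.BSDQuadraticDescent
import Literature.NumberTheory.EllipticCurves.ComplexMultiplication
import Literature.NumberTheory.EllipticCurves.TianYuanZhang2017.GenusPeriodsParity
import Literature.NumberTheory.EllipticCurves.Tian2014.CongruentNumbersHeegnerPoints
import Literature.NumberTheory.EllipticCurves.LiLiuTian2024.CongruentNumberFullBSD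
import Literature.NumberTheory.EllipticCurves.Monsky1990.MockHeegnerCongruentNumbers
import Literature.NumberTheory.EllipticCurves.HeathBrown1994.CongruentTwoSelmerMonskyMatrix
import Literature.NumberTheory.EllipticCurves.Tian2014.CMPointSystemGenusBridge
import Literature.NumberTheory.EllipticCurves.TianYuanZhang2017.GenusPointBlockThm35Displays
import Literature.NumberTheory.EllipticCurves.TianYuanZhang2017.CMPointCompositumDisplays
import Literature.NumberTheory.EllipticCurves.TianYuanZhang2017.CMPointSevenBlockValueDisplays
import HarnessLib

/-!
# Route `PrintCf2`, crux stmt-BirchSwinnertonDyer-20509 `RamifiedOffTYZOfFacts`: **THEOREM A on R2 — the v12 stub `stub_offTYZ_firstNormSquare_R2`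
# PROVED** (cell `bsd-print-cf2`, LEAD cruxlead-20509 g33, line `offtyz-v7`, lineage cycle 34; Theses-free, `def`-free)

HONEST FRAMING (`--supports stmt-BirchSwinnertonDyer-20509`, the registered stub of the v12 skeleton `Lines/offtyz_v12.lean`, BY NAME AND SIGNATURE):
theorems only, no `sorry`, no new named fact.  BSD is not proved by any of this; the crux 20509 stays OPEN (its conjecture-grade stubs C⁺ = item
23431 and the residual 23432 are untouched); what closes here is the ONE print-grade stub of the line.

THE STATEMENT (verbatim from the skeleton): granted the ramified bundle `𝔅_ram` (only its conjunct 7, Rédei–Reichardt, is used) and THEOREM A's three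
print facts (Yang's `x∘i₀ = s²` on `X₀(32)`, injectivity of `i₀` on `Y₀(32)`, Cox's Shimura reciprocity over the ray class field), for primes
`l ≡ 1`, `q ≡ 7 (mod 8)` with `(l/q) = 1`, `n = lq`, every realisation `(M, ι, x₀, y₀, Φ)` of the seven-block display of a genus-point package `D` at `n`
carrying (S3) and the CM value (S4) has its first norm `N₁` (`ι N₁ = ∏_{t∈Φ} t x₀`) a square in `ℍ′_n`.

THE PROOF (g32's kernel road `Lines/offtyz_v7_TheoremARoad.md` §3c, targets (T0)–(T3), all now kernel theorems):
* realisation side (p812870/p812908): `N = Aut(M/ι L_n(i))`, reduce to «fibre count 1 ⟹ `∏_{N•x₀} x` is a square in `M^N`» (`firstNormSquare_of_orbitProd_sq`);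
* CM side: `K = K_n = ℚ(√−n)`, `R = K^{(32)} ⊇ H = H_K`, `e : R → ℂ` over `ι_K`, `j : M → ℂ` with `j x₀ = s(τ)²` ((S4) + Yang), `s₀ ∈ R` with
  `e s₀ = s(τ)` (Cox), the `H`-point `(a_H, b_H)` above `i₀(τ)` (bridge `e(H) = K[1]`), `√l ∈ H` (genus theory), `ζ₄ ∈ R`, `G = Stab(ζ₄) ∩ Stab(√l)`;
* (T0) `j(M^N) = e(R^G)`-type transport (`TheoremAFieldTransport`): `M^N = ℚ(ι i, ι √−d : d ∣ n)` and `j ι i = ±e ζ₄`, `j ι √−l = ±e(ζ₄√l)`,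
  `j ι √−n = ±e √−n`, `j ι √−q = ±e(√−n·√l/l)`;
* (T1) `j(∏_{N•x₀}) = e(∏_{G•s₀²})` (`TheoremATransport.map_prod_orbit_eq_of_range_eq`);
* (T2) `#G•s₀² = g(K)` (`TheoremAHeegnerOrbit.card_orbit_eq_genusClassNumber`, freeness from `TheoremAHeegnerFree`, fibre count 1 transported);
* (T3) `g^{g(K)} s₀ = s₀` for `g ∈ G` (`TheoremAOrderTwoGlobal.pow_genusClassNumber_apply_eq_self` + the local half `TheoremAFieldTransport.artinSymbol_span_apply_eq_self`);
* kernel: `TheoremATargets.orbitProd_sq_of_targets`.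

References: [cite: TianYuanZhang2017, §3.1–3.2, Lemma 3.21 and its proof (p0020 L50–L63)]; [cite: Cox2013, Thm. 15.17, Cor. 15.22, §13.A]; [cite: Yang2006DefiningEquations, §4.1];
[cite: NeukirchANT1999, Ch. VI (7.1)]; tree: p812177, p812870, p812908, p813131, p813336, p813453, p813777, p813802, p813912, p814041, p814194, TheoremAFieldTransport.
-/

noncomputable section

open scoped Classical nonZeroDivisors
open NumberField IsDedekindDomain Complex Finset MulAction
open UpperHalfPlane hiding I

open Literature.NumberTheory.EllipticCurves Literature.NumberTheory.EllipticCurves.TianYuanZhang2017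
open Literature.NumberTheory.EllipticCurves.TianYuanZhang2017.GenusPointData (galPtOver TrivialOnLOver)
open Literature.NumberTheory.EllipticCurves.ModularForms
open Literature.NumberTheory.NumberFields Literature.NumberTheory.GaloisRepresentations
open Literature.NumberTheory.LFunctions.AbelianDensity (artinSymbol)
open Literature.NumberTheory.ComplexMultiplication.EllipticUnits (exists_isPrimitiveRoot_rayClassField)
open Summit.BirchSwinnertonDyer.PrintCf2.TheoremAHilbertBridge Summit.BirchSwinnertonDyer.PrintCf2.TheoremAAmbiguous
open Summit.BirchSwinnertonDyer.PrintCf2.TheoremAOrderTwoGlobal Summit.BirchSwinnertonDyer.PrintCf2.TheoremAOrbitCount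
open Summit.BirchSwinnertonDyer.PrintCf2.TheoremAHeegnerOrbit Summit.BirchSwinnertonDyer.PrintCf2.TheoremAHeegnerFree
open Summit.BirchSwinnertonDyer.PrintCf2.TheoremATransport Summit.BirchSwinnertonDyer.PrintCf2.TheoremATargets
open Summit.BirchSwinnertonDyer.PrintCf2.TheoremARealisation Summit.BirchSwinnertonDyer.PrintCf2.TheoremAField
open Summit.BirchSwinnertonDyer.PrintCf2.TheoremAFieldTransport

namespace Summit.BirchSwinnertonDyer.PrintCf2

/-- ★★★ **THEOREM A on R2 — the v12 stub `stub_offTYZ_firstNormSquare_R2` of line `offtyz-v7`, PROVED.**  Granted `𝔅_ram` (conjunct 7, Rédei–Reichardt)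
and THEOREM A's three print facts (Yang's coordinates, injectivity of `i₀` on `Y₀(32)`, Cox's reciprocity), for primes `l ≡ 1`, `q ≡ 7 (mod 8)` with
`(l/q) = 1` and `n = lq`: in every realisation of the seven-block display at `n` carrying (S3) and the CM value (S4), the first norm
`N₁` (`ι N₁ = ∏_{t∈Φ} t x₀`) is a square in `ℍ′_n`.  Proof: module docstring (targets (T0)–(T3) of the kernel road).
[cite: TianYuanZhang2017, §3.1–3.2, Lemma 3.21 and its proof (p0020 L50–L63)] [cite: Cox2013, Thm. 15.17, Cor. 15.22] [cite: Yang2006DefiningEquations, §4.1] -/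
theorem stub_offTYZ_firstNormSquare_R2 : (Literature.NumberTheory.EllipticCurves.rank_eq_analyticRank_of_analyticRank_le_one ∧ WeierstrassCurve.hasEntireLFunction_rat ∧ WeierstrassCurve.bsdRHS_eq_of_isIsogenous ∧ Literature.NumberTheory.EllipticCurves.bsdTriple_of_hasCM_of_L_one_ne_zero ∧ Literature.NumberTheory.EllipticCurves.TianYuanZhang2017.thm12_parity_of_scriptL' ∧ Literature.NumberTheory.EllipticCurves.Tian2014.thm13_rank_one_and_sha_odd ∧ Literature.NumberTheory.QuadraticFields.RedeiReichardt.redeiReichardt_fourTwoCard_classGroup ∧ Literature.NumberTheory.EllipticCurves.LiLiuTian2024.thm12_bsd_congruentNumberCurve ∧ Literature.NumberTheory.EllipticCurves.Monsky1990.cor515_rank_eq_one_and_card_selmerGroup_two ∧ Literature.NumberTheory.EllipticCurves.HeathBrown1994.monsky_card_selmerGroup_two_even ∧ Literature.NumberTheory.EllipticCurves.Tian2014.tian2014_system_sMinus_genus) →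
    (Literature.NumberTheory.EllipticCurves.ModularForms.x032_φ_eq_etaQuotient ∧ Literature.NumberTheory.EllipticCurves.ModularForms.x032_φ_injective ∧ Literature.NumberTheory.ComplexMultiplication.Cox2013.cox2013_shimuraReciprocity_rayClassField) →
    ∀ (l q n : ℕ), l.Prime → q.Prime → l % 8 = 1 → q % 8 = 7 → IsSquare ((l : ℤ) : ZMod q) → n = l * q →
      (congruentNumberCurve n).analyticRank = 1 →
      ∀ (D : GenusPointData n), D.Printed → D.CMPointCompositumPrinted → D.Thm35AtBlocks →
      ∀ (M : Type) (_ : Field M) (_ : NumberField M) (_ : IsGalois ℚ M) (ι : D.H →ₐ[ℚ] M) (x₀ y₀ : M)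
        (h₀ : (curveA.baseChange M).toAffine.Nonsingular x₀ y₀) (Φ : Finset (M ≃ₐ[ℚ] M)),
        (WeierstrassCurve.Affine.Point.map (W' := curveA) ι (D.Z n) = ∑ t ∈ Φ, GenusPointData.galPtOver M t (.some x₀ y₀ h₀) ∧ Φ.card = gK n) →
        (∀ t ∈ Φ, ¬ ((2 : ℕ) • GenusPointData.galPtOver M t (.some x₀ y₀ h₀) = 0 ∨ (2 : ℕ) • GenusPointData.galPtOver M t (.some x₀ y₀ h₀) = tauOne)) →
        (∀ g : M ≃ₐ[ℚ] M, D.TrivialOnLOver ι n g →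
          ∃ π : Φ → Φ, Function.Bijective π ∧
            ∀ t : Φ, GenusPointData.galPtOver M g (GenusPointData.galPtOver M (t : M ≃ₐ[ℚ] M) (.some x₀ y₀ h₀)) =
              GenusPointData.galPtOver M (π t : M ≃ₐ[ℚ] M) (.some x₀ y₀ h₀)) →
        SevenBlockCMValue (.some x₀ y₀ h₀) n →
        ∀ N₁ : D.H, ι N₁ = ∏ t ∈ Φ, (t : M ≃ₐ[ℚ] M) x₀ → ∃ r : D.H, N₁ = r ^ 2 := by
  intro hB hP l q n hl hq hl8 hq8 hlsq hn _hrank D _hD1 _hD2 _hD3 M _instF _instNF _instG ι x₀ y₀ h₀ Φ _hS1 _hS2 hS3 h4 N₁ hN₁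
  obtain ⟨hYang, hInj, hCox⟩ := hP
  have hRR := hB.2.2.2.2.2.2.1
  /- 1. numerics of `n = lq` -/
  have hlq : l ≠ q := by omega
  have hl4 : l % 4 = 1 := by omega
  have hq4 : q % 4 = 3 := by omega
  have hq5 : 4 < q := by omega
  have hl1 : 1 < l := hl.one_lt
  have hn7 : n % 8 = 7 := by rw [hn, Nat.mul_mod, hl8, hq8]
  have hn1 : 1 < n := by rw [hn]; nlinarith
  have hn0 : 0 < n := by omega
  have hcop : l.Coprime q := (Nat.coprime_primes hl hq).mpr hlq
  have hsqf : Squarefree n := by rw [hn]; exact (Nat.squarefree_mul hcop).mpr ⟨hl.prime.squarefree, hq.prime.squarefree⟩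
  have hjac := jacobiSym_eq_one_of_isSquare hl hq hlq hlsq
  /- 2. realisation side: reduce to the orbit product under `N = Aut(M / ι L_n(i))` -/
  obtain ⟨N, hN⟩ := exists_subgroup_trivialOnLOver D ι
  refine firstNormSquare_of_orbitProd_sq D ι hS3 N hN ?_ N₁ hN₁
  intro hcount
  /- 3. the CM value: `j x₀ = s(τ)²`, `Dt.φ τ = (j x₀, j y₀)` -/
  obtain ⟨j, δ, Dt, hj, hδ, hdeg, hz⟩ := h4.exists_map_eq_some
  obtain ⟨yτ, hyτ, hφ, _hy⟩ := hYang Dt hdeg (heegnerTau (sevenBlockForm n δ))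
  have hjxy : etaQuotient 32 rX (heegnerTau (sevenBlockForm n δ)) = j x₀ ∧ yτ = j y₀ := by
    rw [hφ] at hz
    simpa using (WeierstrassCurve.Affine.Point.some.injEq _ _ _ _ _ _).mp hz
  have hjx : j x₀ = etaQuotient 32 rS (heegnerTau (sevenBlockForm n δ)) ^ 2 := by rw [← hjxy.1, etaQuotient_rX_eq_sq]
  /- 4. the field `K = K_n`, `θ`, `Q_{n,δ} = (a, b, c)` -/
  have hK : IsImaginaryQuadratic (GenusField n) := isImaginaryQuadratic_genusField hn1.le
  haveI := hK.isTotallyComplex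
  obtain ⟨ιK, hιK⟩ := exists_ringHom_genusField_complex n hn1.le
  have hd' : NumberField.discr (GenusField n) = -(n : ℤ) := discr_genusField hn1 (by omega) hsqf
  have hd : NumberField.discr (GenusField n) = -((l * q : ℕ) : ℤ) := by rw [hd', hn]
  have hδodd : Odd δ := odd_of_dvd_add_sq (Nat.odd_iff.mpr (by omega)) hδ
  obtain ⟨θ, hθ, hgen⟩ := exists_theta_genusField hn7 hsqf hδodd
  have hθC := map_theta_eq_mul_heegnerTau hn0 hδ hιK hθ
  obtain ⟨ha, hD, hprim, h32⟩ := sevenBlockForm_hyps hn0 hδ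
  have hθrel := theta_rel hn1.le hδ hθ
  set w : 𝓞 (GenusField n) := θ + θ + (δ : 𝓞 (GenusField n)) with hwdef
  have hwK : (w : GenusField n) = AdjoinRoot.root (genusFieldPoly n) := coe_two_mul_theta_add hθ
  have hw : w ^ 2 = -((l * q : ℕ) : 𝓞 (GenusField n)) := by rw [← hn]; exact sq_two_mul_theta_add hn1.le hθ
  have hKsq : Tian2014.IsQuadraticFieldOfSqrt (GenusField n) (-((l * q : ℕ) : ℤ)) := by
    rw [← hn]; exact isQuadraticFieldOfSqrt_genusField hn1.le
  /- 5. `R = K^{(32)}`, `e`, `s₀` with `e s₀ = s(τ)` (Cox) -/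
  have h𝔪 : (Ideal.span {((32 : ℕ) : 𝓞 (GenusField n))} : Ideal (𝓞 (GenusField n))) ≠ ⊥ := by
    rw [Ne, Ideal.span_singleton_eq_bot]; exact_mod_cast (by norm_num : (32 : ℕ) ≠ 0)
  obtain ⟨e, he⟩ := exists_ringHom_rayClassField_complex (GenusField n) ιK (Ideal.span {((32 : ℕ) : 𝓞 (GenusField n))})
  obtain ⟨s₀, hs₀⟩ : ∃ s₀ : rayClassField (GenusField n) (Ideal.span {((32 : ℕ) : 𝓞 (GenusField n))}),
      e s₀ = etaQuotient 32 rS (heegnerTau (sevenBlockForm n δ)) :=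
    (Literature.NumberTheory.ComplexMultiplication.Cox2013.artinSymbol_etaQuotient_rS_of_fact hCox (GenusField n) ιK hK _ _ _ ha hD hprim θ
      hθC hgen e he).1
  have hxa : j x₀ = e (s₀ * s₀) := by rw [hjx, map_mul, hs₀, pow_two]
  /- 6. the `H`-point `(a_H, b_H)` above `i₀(τ)`, `√l ∈ H`, `ζ₄ ∈ R` -/
  have hQmem : sevenBlockForm n δ ∈ heegnerForms 32 (NumberField.discr (GenusField n)) := by
    rw [hd']; exact sevenBlockForm_mem_heegnerForms hn0 hδ
  obtain ⟨P, hP⟩ := exists_point_map_eq_phi hK ιK h𝔪 e he Dt hQmem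
  obtain ⟨aH, bH, hab, rfl⟩ : ∃ a b h, P = .some a b h := by
    cases P with
    | zero =>
      exfalso
      have h0 := hP
      change (0 : (curveA.baseChange ℂ).toAffine.Point) = _ at h0
      rw [hφ] at h0
      cases h0
    | some a b h => exact ⟨a, b, h, rfl⟩
  obtain ⟨rl, hrl⟩ := exists_mem_sq_eq_natCast_of_dvd_discr hK ιK h𝔪 e he hl hl4 (by rw [hd]; exact ⟨-(q : ℤ), by push_cast; ring⟩)
  have h32le : (Ideal.span {((32 : ℕ) : 𝓞 (GenusField n))} : Ideal (𝓞 (GenusField n))) ≤ Ideal.span {((4 : ℕ) : 𝓞 (GenusField n))} := by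
    rw [Ideal.span_singleton_le_span_singleton]; exact ⟨(8 : ℕ), by push_cast; norm_num⟩
  obtain ⟨ζ, hζ⟩ := exists_isPrimitiveRoot_rayClassField (K := GenusField n) (m := 4) h𝔪 h32le
  have hζ2 : ζ ^ 2 = -1 := sq_eq_neg_one_of_isPrimitiveRoot_four hζ
  set incl := IntermediateField.inclusion (hilbertClassField_le_rayClassField (K := GenusField n) h𝔪) with hincl
  have hPab : e (incl aH) = etaQuotient 32 rX (heegnerTau (sevenBlockForm n δ)) ∧ e (incl bH) = yτ := by
    have hP' := hP
    rw [WeierstrassCurve.Affine.Point.map_some, hφ] at hP'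
    have := (WeierstrassCurve.Affine.Point.some.injEq _ _ _ _ _ _).mp hP'
    simpa [RingHom.toRatAlgHom_apply] using this
  have ha2 : incl aH = s₀ * s₀ := e.injective (by rw [hPab.1, map_mul, hs₀, ← pow_two, etaQuotient_rX_eq_sq])
  have hb2 : e (incl bH) = j y₀ := by rw [hPab.2, hjxy.2]
  /- 7. the group `G = Stab(ζ₄) ∩ Stab(√l) ≤ Gal(R/K)` -/
  set Gs : Subgroup (rayClassField (GenusField n) (Ideal.span {((32 : ℕ) : 𝓞 (GenusField n))}) ≃ₐ[GenusField n] rayClassField (GenusField n) (Ideal.span {((32 : ℕ) : 𝓞 (GenusField n))})) :=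
    MulAction.stabilizer (rayClassField (GenusField n) (Ideal.span {((32 : ℕ) : 𝓞 (GenusField n))}) ≃ₐ[GenusField n] rayClassField (GenusField n) (Ideal.span {((32 : ℕ) : 𝓞 (GenusField n))})) ζ ⊓ MulAction.stabilizer (rayClassField (GenusField n) (Ideal.span {((32 : ℕ) : 𝓞 (GenusField n))}) ≃ₐ[GenusField n] rayClassField (GenusField n) (Ideal.span {((32 : ℕ) : 𝓞 (GenusField n))})) (incl rl) with hGs
  have hGmem : ∀ g : rayClassField (GenusField n) (Ideal.span {((32 : ℕ) : 𝓞 (GenusField n))}) ≃ₐ[GenusField n] rayClassField (GenusField n) (Ideal.span {((32 : ℕ) : 𝓞 (GenusField n))}), g ∈ Gs ↔ g ζ = ζ ∧ g (incl rl) = incl rl := fun g => by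
    rw [hGs, Subgroup.mem_inf, MulAction.mem_stabilizer_iff, MulAction.mem_stabilizer_iff, AlgEquiv.smul_def, AlgEquiv.smul_def]
  /- 8. (T0): generators of `M^N` and of `R^G`, located in `ℂ` up to sign -/
  have himF : ι D.im ∈ IntermediateField.fixedField N := by
    rw [IntermediateField.mem_fixedField_iff]; intro g hg; exact ((hN g).mp hg).1
  have hsqF : ∀ d ∈ n.divisors, 1 < d → ι (D.sqrtNeg d) ∈ IntermediateField.fixedField N := by
    intro d hd hd1; rw [IntermediateField.mem_fixedField_iff]; intro g hg; exact ((hN g).mp hg).2 d hd hd1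
  have hlmem : l ∈ n.divisors := Nat.mem_divisors.mpr ⟨⟨q, hn⟩, hn0.ne'⟩
  have hqmem : q ∈ n.divisors := Nat.mem_divisors.mpr ⟨⟨l, by rw [hn, mul_comm]⟩, hn0.ne'⟩
  have hnmem : n ∈ n.divisors := Nat.mem_divisors_self n hn0.ne'
  set SM : Set M := insert (ι D.im) ((fun d => ι (D.sqrtNeg d)) '' {d | d ∈ n.divisors ∧ 1 < d}) with hSM
  have hSN : ∀ g : M ≃ₐ[ℚ] M, (∀ s ∈ SM, g s = s) → g ∈ N := by
    intro g hg
    rw [hN]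
    exact ⟨hg _ (Set.mem_insert _ _), fun d hd hd1 => hg _ (Set.mem_insert_of_mem _ ⟨d, ⟨hd, hd1⟩, rfl⟩)⟩
  have hFle : ∀ m ∈ IntermediateField.fixedField N, m ∈ IntermediateField.adjoin ℚ SM :=
    fun m hm => mem_adjoin_of_mem_fixedField N SM hSN hm
  have hjim : (j (ι D.im)) ^ 2 = -1 := by rw [← map_pow, ← map_pow, D.im_sq]; simp
  have hjsq : ∀ d ∈ n.divisors, (j (ι (D.sqrtNeg d))) ^ 2 = -(d : ℂ) := by
    intro d hd; rw [← map_pow, ← map_pow, D.sqrtNeg_sq d hd]; simp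
  set rootR : rayClassField (GenusField n) (Ideal.span {((32 : ℕ) : 𝓞 (GenusField n))}) := algebraMap (GenusField n) (rayClassField (GenusField n) (Ideal.span {((32 : ℕ) : 𝓞 (GenusField n))})) (AdjoinRoot.root (genusFieldPoly n)) with hrootR
  have heζ : (e ζ) ^ 2 = -1 := by rw [← map_pow, hζ2]; simp
  have herl : (e (incl rl)) ^ 2 = (l : ℂ) := by rw [← map_pow, hrl]; simp
  have heroot : (e rootR) ^ 2 = -(n : ℂ) := by
    rw [← map_pow, hrootR, ← map_pow, root_genusField_sq hn1.le, he]; simp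
  set T₀ : Set (rayClassField (GenusField n) (Ideal.span {((32 : ℕ) : 𝓞 (GenusField n))})) := {ζ, incl rl, rootR} with hT₀
  set E₀ : IntermediateField ℚ (rayClassField (GenusField n) (Ideal.span {((32 : ℕ) : 𝓞 (GenusField n))})) := IntermediateField.adjoin ℚ T₀ with hE₀
  have hζT : ζ ∈ T₀ := by simp [hT₀]
  have hrlT : incl rl ∈ T₀ := by simp [hT₀]
  have hrootT : rootR ∈ T₀ := by simp [hT₀]
  have hζE : ζ ∈ E₀ := IntermediateField.subset_adjoin ℚ T₀ hζT
  have hrlE : incl rl ∈ E₀ := IntermediateField.subset_adjoin ℚ T₀ hrlT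
  have hrootE : rootR ∈ E₀ := IntermediateField.subset_adjoin ℚ T₀ hrootT
  have hdivs : ∀ d ∈ n.divisors, 1 < d → d = l ∨ d = q ∨ d = l * q := fun d hd hd1 =>
    eq_of_dvd_prime_mul_prime hl hq (hn ▸ Nat.dvd_of_mem_divisors hd) hd1
  -- (★A) `j(S_M) ⊆ e(E₀)`
  have hA : j '' SM ⊆ e '' (E₀ : Set (rayClassField (GenusField n) (Ideal.span {((32 : ℕ) : 𝓞 (GenusField n))}))) := by
    have hneg : ∀ t ∈ (E₀ : Set (rayClassField (GenusField n) (Ideal.span {((32 : ℕ) : 𝓞 (GenusField n))}))), -t ∈ (E₀ : Set (rayClassField (GenusField n) (Ideal.span {((32 : ℕ) : 𝓞 (GenusField n))}))) := fun t ht => neg_mem ht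
    rintro _ ⟨s, hs, rfl⟩
    rcases hs with rfl | ⟨d, ⟨hdm, hd1⟩, rfl⟩
    · exact mem_image_of_sq_eq e hneg hζE (by rw [hjim, heζ])
    · have hjd := hjsq d hdm
      rcases hdivs d hdm hd1 with hdl | hdq | hdn
      · rw [hdl] at hjd
        exact mem_image_of_sq_eq e hneg (mul_mem hζE hrlE) (by rw [hdl, hjd, map_mul, mul_pow, heζ, herl]; ring)
      · rw [hdq] at hjd
        have hl0 : (l : ℂ) ≠ 0 := by exact_mod_cast hl.ne_zero
        refine mem_image_of_sq_eq e hneg (t := rootR * incl rl * ((l : ℕ) : rayClassField (GenusField n) (Ideal.span {((32 : ℕ) : 𝓞 (GenusField n))}))⁻¹)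
          (mul_mem (mul_mem hrootE hrlE) (inv_mem (natCast_mem E₀ l))) ?_
        rw [hdq, hjd, map_mul, map_mul, map_inv₀, map_natCast, mul_pow, mul_pow, heroot, herl, hn, inv_pow]
        field_simp
        push_cast; ring
      · rw [hdn] at hjd
        exact mem_image_of_sq_eq e hneg hrootE (by rw [hdn, hjd, heroot, hn])
  -- (★B) `e(T₀) ⊆ j(M^N)` and `e(K) ⊆ j(M^N)`
  have hB : ∀ t ∈ T₀, ∃ m ∈ IntermediateField.fixedField N, j m = e t := by
    intro t ht
    simp only [hT₀, Set.mem_insert_iff, Set.mem_singleton_iff] at ht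
    rcases ht with rfl | rfl | rfl
    · exact exists_mem_eq_of_sq_eq j himF (by rw [heζ, hjim])
    · exact exists_mem_eq_of_sq_eq j (mul_mem himF (hsqF l hlmem hl1))
        (by rw [herl, map_mul, mul_pow, hjim, hjsq l hlmem]; ring)
    · exact exists_mem_eq_of_sq_eq j (hsqF n hnmem hn1) (by rw [heroot, hjsq n hnmem])
  have hKF : ∀ k : GenusField n, ∃ m ∈ IntermediateField.fixedField N, j m = e (algebraMap (GenusField n) (rayClassField (GenusField n) (Ideal.span {((32 : ℕ) : 𝓞 (GenusField n))})) k) := by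
    have h := forall_exists_mem_of_adjoin_eq_top ιK j (IntermediateField.fixedField N) (θ := AdjoinRoot.root (genusFieldPoly n))
      (AdjoinRoot.adjoinRoot_eq_top) ?_
    · intro k; obtain ⟨m, hm, hmk⟩ := h k; exact ⟨m, hm, by rw [hmk, he]⟩
    · obtain ⟨m, hm, hmt⟩ := hB rootR hrootT; exact ⟨m, hm, by rw [hmt, hrootR, he]⟩
  /- 9. (T1): the two ranges agree -/
  have hfixT : ∀ g ∈ Gs, ∀ t ∈ T₀, g t = t := by
    intro g hg t ht
    simp only [hT₀, Set.mem_insert_iff, Set.mem_singleton_iff] at ht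
    rcases ht with rfl | rfl | rfl
    · exact ((hGmem g).mp hg).1
    · exact ((hGmem g).mp hg).2
    · exact g.commutes _
  have hfixE : ∀ g ∈ Gs, ∀ r ∈ E₀, g r = r := fun g hg r hr => apply_eq_of_mem_adjoin g (hfixT g hg) hr
  have h₁ : ∀ r : rayClassField (GenusField n) (Ideal.span {((32 : ℕ) : 𝓞 (GenusField n))}), (∀ g : Gs, g • r = r) → ∃ m : M, (∀ g : N, g • m = m) ∧ j m = e r := by
    intro r hr
    obtain ⟨m, hm, hmr⟩ := exists_mem_of_forall_fix j e (IntermediateField.fixedField N) T₀ hB hKF r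
      (fun g hg => by simpa [AlgEquiv.smul_def] using hr ⟨g, (hGmem g).mpr ⟨hg _ hζT, hg _ hrlT⟩⟩)
    exact ⟨m, fun g => (IntermediateField.mem_fixedField_iff N m).mp hm g g.2, hmr⟩
  have h₂mem : ∀ m ∈ IntermediateField.fixedField N, ∃ r ∈ E₀, e r = j m := by
    intro m hm
    obtain ⟨r, hr, hre⟩ := exists_mem_adjoin_of_image_subset j e hA (hFle m hm)
    exact ⟨r, (IntermediateField.adjoin_le_iff.mpr subset_rfl : IntermediateField.adjoin ℚ (E₀ : Set (rayClassField (GenusField n) (Ideal.span {((32 : ℕ) : 𝓞 (GenusField n))}))) ≤ E₀) hr, hre⟩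
  have h₂ : ∀ m : M, (∀ g : N, g • m = m) → ∃ r : rayClassField (GenusField n) (Ideal.span {((32 : ℕ) : 𝓞 (GenusField n))}), (∀ g : Gs, g • r = r) ∧ e r = j m := by
    intro m hm
    have hm' : m ∈ IntermediateField.fixedField N := (IntermediateField.mem_fixedField_iff N m).mpr fun g hg => hm ⟨g, hg⟩
    obtain ⟨r, hr, hre⟩ := h₂mem m hm'
    exact ⟨r, fun g => by rw [Subgroup.smul_def, AlgEquiv.smul_def]; exact hfixE g g.2 r hr, hre⟩
  have hT1 := map_prod_orbit_eq_of_range_eq N Gs j e x₀ (s₀ * s₀) hxa h₁ h₂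
  have hT1' : ∀ r : rayClassField (GenusField n) (Ideal.span {((32 : ℕ) : 𝓞 (GenusField n))}), (∀ g : Gs, g • r = r) → ∃ m ∈ (IntermediateField.fixedField N : Set M), j m = e r := by
    intro r hr
    obtain ⟨m, hm, hmr⟩ := h₁ r hr
    exact ⟨m, (IntermediateField.mem_fixedField_iff N m).mpr fun g hg => hm ⟨g, hg⟩, hmr⟩
  /- 10. (T2): `#G•s₀² = g(K)` — freeness (Heegner) and the fibre (count 1) -/
  have hSH := satisfiesHeegnerHypothesis_genusField hn1 hn7 hsqf
  have hfree : ∀ σ : hilbertClassField (GenusField n) ≃ₐ[GenusField n] hilbertClassField (GenusField n), σ aH = aH → σ bH = bH → σ = 1 := by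
    intro σ h1 h2
    refine algEquiv_eq_one_of_map_point_eq hInj hK hSH ιK h𝔪 e he Dt hdeg hQmem (.some aH bH hab) hP σ ?_
    rw [WeierstrassCurve.Affine.Point.map_some]
    exact (WeierstrassCurve.Affine.Point.some.injEq _ _ _ _ _ _).mpr ⟨by simpa using h1, by simpa using h2⟩
  have hy₀ : y₀ ∈ IntermediateField.adjoin ℚ ((IntermediateField.fixedField N : Set M) ∪ {x₀}) :=
    mem_adjoin_of_stabilizer_fixes N x₀ y₀ fun ν hν => smul_snd_eq_of_count_eq_one N x₀ y₀ hcount ν hν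
  have hST2 : j '' ((IntermediateField.fixedField N : Set M) ∪ {x₀}) ⊆ e '' ((E₀ : Set (rayClassField (GenusField n) (Ideal.span {((32 : ℕ) : 𝓞 (GenusField n))}))) ∪ {incl aH}) := by
    rintro _ ⟨m, hm, rfl⟩
    rcases hm with hm | hm
    · obtain ⟨r, hr, hre⟩ := h₂mem m hm
      exact ⟨r, Set.mem_union_left _ hr, hre⟩
    · rw [Set.mem_singleton_iff] at hm
      subst hm
      exact ⟨incl aH, Set.mem_union_right _ (Set.mem_singleton _), by rw [ha2, hxa]⟩
  have hbH : incl bH ∈ IntermediateField.adjoin ℚ ((E₀ : Set (rayClassField (GenusField n) (Ideal.span {((32 : ℕ) : 𝓞 (GenusField n))}))) ∪ {incl aH}) := mem_adjoin_of_image_subset j e hST2 hy₀ hb2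
  have hfib : ∀ g ∈ Gs, g (incl aH) = incl aH → g (incl bH) = incl bH := by
    intro g hg hga
    refine apply_eq_of_mem_adjoin g (fun t ht => ?_) hbH
    rcases ht with ht | ht
    · exact hfixE g hg t ht
    · rw [Set.mem_singleton_iff] at ht
      rw [ht]; exact hga
  have hG1 : ∀ g ∈ Gs, g (incl rl) = incl rl := fun g hg => ((hGmem g).mp hg).2
  have hG3 : ∀ g : rayClassField (GenusField n) (Ideal.span {((32 : ℕ) : 𝓞 (GenusField n))}) ≃ₐ[GenusField n] rayClassField (GenusField n) (Ideal.span {((32 : ℕ) : 𝓞 (GenusField n))}), g (incl rl) = incl rl → g ζ = ζ → g ∈ Gs := fun g h1 h2 => (hGmem g).mpr ⟨h2, h1⟩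
  have hcardG : ((univ : Finset Gs).image (fun g : Gs => g • (s₀ * s₀))).card = genusClassNumber (GenusField n) := by
    rw [← ha2]
    convert card_orbit_eq_genusClassNumber hK hl hq hl4 hq4 hd w hw h𝔪 rl hrl ζ hζ Gs hG1 hG3 aH bH hfree hfib using 2
  /- 11. (T3): `g^{g(K)} s₀ = s₀` on `G` -/
  have hloc := artinSymbol_span_apply_eq_self hCox (GenusField n) ιK hK _ _ _ ha hD hprim h32 θ hθC hθrel hgen e he hl8 s₀ hs₀
  have hT3 : ∀ g : Gs, (g ^ ((univ : Finset Gs).image (fun g : Gs => g • (s₀ * s₀))).card) • s₀ = s₀ := by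
    intro g
    rw [hcardG, Subgroup.smul_def, Subgroup.coe_pow, AlgEquiv.smul_def]
    exact pow_genusClassNumber_apply_eq_self hRR hK hl hq hl4 hq4 hq5 hjac hd hKsq w hw h𝔪 s₀ aH ha2 rl hrl hloc
      (g : rayClassField (GenusField n) (Ideal.span {((32 : ℕ) : 𝓞 (GenusField n))}) ≃ₐ[GenusField n] rayClassField (GenusField n) (Ideal.span {((32 : ℕ) : 𝓞 (GenusField n))})) (hG1 g g.2)
  /- 12. the kernel -/
  obtain ⟨m, hm, hQ⟩ := orbitProd_sq_of_targets (G := Gs) j e s₀ (IntermediateField.fixedField N : Set M) hT1 hT1'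
    (fun g => by convert hT3 g using 7)
  exact ⟨m, hm, hQ⟩

end Summit.BirchSwinnertonDyer.PrintCf2

end
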